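import Mathlib
import Summits.ValiantsHypothesis.ValiantsHypothesis.Theorems.LacunarySymmetroidMatrixDescartesDefiniteMoments

/-!
# `MatrixDescartes` (stmt-ValiantsHypothesis-18050) — the DEFINITE-MOMENTS LAW, III: kit for the sign-word form
# (sign variations of block-signed coefficient sequences; signs of a real polynomial near `0⁺` and near `+∞`;
# zeros forced by a sign sequence; the directed window count)

HONEST FRAMING.  Cell `pub-symmetroid`, seat `val-sym-mdr-p2` (gen 14); helper file `--supports` the crux
`Theses.LacunarySymmetroid.MatrixDescartes`, NO closure claim; elementary tools for `…DefiniteMomentsWord`.  Nothing here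
bears on the crux in its window, on `stub_twoSided`, on `DoorA26`/`DoorA34`, registers, or `VP ≠ VNP`.

CONTENTS.  (1) `signVariations_add_le_of_signPattern`: if the coefficients of a real polynomial `P ≠ 0` follow a BLOCK
SIGN PATTERN — `0 ≤ (−1)^{β n}·[Xⁿ]P` for a monotone `β : ℕ → ℕ` — then `Var(P) + β(n) ≤ β(deg P)` for every lower
bound `β(n)` of `β` on the support; with Descartes' rule (Mathlib `roots_countP_pos_le_signVariations`) this is the
ZERO BUDGET of a Rayleigh form of a semidefinite sign word: «number of positive zeros ≤ (last visible block) − (first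
visible block)».  (2) `eventually_pos_near_zero` / `eventually_pos_atTop`: a real polynomial has the sign of its
trailing coefficient on some `(0, δ)` and the sign of its leading coefficient on some `(M, ∞)`.  (3)
`zeros_in_changing_gaps`: for a continuous `f`, points `0 < q₀ < ⋯ < q_L` with `f(qⱼ) ≠ 0`, and the budget «at most
as many distinct positive zeros as sign changes along `(f(qⱼ))ⱼ`», every positive zero of `f` sits in a sign-changing
gap, exactly one per such gap (the accounting of `…DefiniteMoments.gapZeros` for arbitrary sign sequences).  (4)
`card_roots_filter_le_of_directed_down`: the tree's directed kernel chain (`MomentLaw.card_le_of_directed`) packaged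
for a signed pencil `c • F` on an arbitrary decidable set of times: if `0 ≤ c·f_v(t) ⇒ 0 < c·f_v(s)` for `s < t` in the
set, then `det F` has at most `card ι` zeros there.  [folklore]; axioms `propext`, `Classical.choice`, `Quot.sound`.
-/

-- layout Summits/ValiantsHypothesis/ValiantsHypothesis forces the duplicated namespace component
set_option linter.dupNamespace false

namespace Summit.ValiantsHypothesis.ValiantsHypothesis.Theorems.LacunarySymmetroidMatrixDescartes

open Polynomial Matrix Finset
open scoped BigOperators

namespace DefiniteMoments

/-! ## §1 Sign variations of a block-signed coefficient sequence -/

/-- A non-zero real `a` and a real `b` with `0 ≤ ε·a`, `0 ≤ ε·b` for the same sign `ε = (−1)^m` cannot have opposite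
strict signs. [folklore] -/
theorem sign_ne_neg_sign_of_pattern {a b : ℝ} (ha : a ≠ 0) (m : ℕ) (ha' : 0 ≤ (-1 : ℝ) ^ m * a)
    (hb' : 0 ≤ (-1 : ℝ) ^ m * b) : SignType.sign a ≠ -SignType.sign b := by
  intro h
  have hab : 0 ≤ a * b := by
    have e : a * b = ((-1 : ℝ) ^ m * a) * ((-1 : ℝ) ^ m * b) := by
      have h1 : ((-1 : ℝ) ^ m) * ((-1 : ℝ) ^ m) = 1 := by
        rw [← mul_pow, neg_one_mul, neg_neg, one_pow]
      calc a * b = (((-1 : ℝ) ^ m) * ((-1 : ℝ) ^ m)) * (a * b) := by rw [h1, one_mul]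
        _ = _ := by ring
    rw [e]
    exact mul_nonneg ha' hb'
  rcases lt_or_gt_of_ne ha with ha0 | ha0
  · rw [sign_neg ha0] at h
    have hb0 : 0 < b := sign_eq_one_iff.1 (by rw [← neg_neg (SignType.sign b), ← h]; rfl)
    nlinarith
  · rw [sign_pos ha0] at h
    have hb0 : b < 0 := sign_eq_neg_one_iff.1 (by rw [← neg_neg (SignType.sign b), ← h])
    nlinarith

/-- **Sign variations under a block sign pattern.**  Let `β : ℕ → ℕ` be monotone and `P ≠ 0` a real polynomial with
`0 ≤ (−1)^{β n}·[Xⁿ]P` for every `n` (the coefficient at `Xⁿ` is zero or has the sign of "block" `β n`).  Then for every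
`b₀` with `b₀ ≤ β n` on the support of `P`: `Var(P) + b₀ ≤ β(deg P)` — the coefficient signs can only change where the
block index increases.  (Induction on the support via Mathlib's `signVariations_eq_eraseLead_add_ite`.) [folklore] -/
theorem signVariations_add_le_of_signPattern (β : ℕ → ℕ) (hβ : Monotone β) :
    ∀ (N : ℕ) (P : ℝ[X]), P.support.card ≤ N → P ≠ 0 → (∀ n, 0 ≤ (-1 : ℝ) ^ β n * P.coeff n) →
      ∀ b₀ : ℕ, (∀ n ∈ P.support, b₀ ≤ β n) → P.signVariations + b₀ ≤ β P.natDegree := by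
  intro N
  induction N with
  | zero =>
    intro P hcard hP
    exact absurd (Polynomial.card_support_eq_zero.1 (Nat.le_zero.1 hcard)) hP
  | succ N ih =>
    intro P hcard hP hsign b₀ hb₀
    have hdegmem : P.natDegree ∈ P.support := Polynomial.natDegree_mem_support_of_nonzero hP
    rw [Polynomial.signVariations_eq_eraseLead_add_ite hP]
    set Q := P.eraseLead with hQ
    by_cases hQ0 : Q = 0
    · have hc : ¬ (SignType.sign P.leadingCoeff = -SignType.sign Q.leadingCoeff) := by
        rw [hQ0, Polynomial.leadingCoeff_zero, sign_zero, neg_zero, sign_eq_zero_iff]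
        exact Polynomial.leadingCoeff_ne_zero.2 hP
      rw [hQ0, Polynomial.signVariations_zero, if_neg (by rwa [hQ0] at hc), zero_add, zero_add]
      exact hb₀ _ hdegmem
    · -- the induction hypothesis for `Q = eraseLead P`
      have hQcard : Q.support.card ≤ N :=
        Nat.le_of_lt_succ (lt_of_lt_of_le (Polynomial.eraseLead_support_card_lt hP) hcard)
      have hQsign : ∀ n, 0 ≤ (-1 : ℝ) ^ β n * Q.coeff n := by
        intro n
        rw [hQ, Polynomial.eraseLead_coeff]
        split_ifs
        · rw [mul_zero]
        · exact hsign n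
      have hQsupp : ∀ n ∈ Q.support, b₀ ≤ β n := by
        intro n hn
        rw [hQ, Polynomial.eraseLead_support] at hn
        exact hb₀ n (Finset.mem_of_mem_erase hn)
      have hIH := ih Q hQcard hQ0 hQsign b₀ hQsupp
      have hdegle : Q.natDegree ≤ P.natDegree := (Polynomial.eraseLead_natDegree_le P).trans (Nat.sub_le _ _)
      have hdegne : Q.natDegree ≠ P.natDegree := by
        intro h
        have h1 : Q.coeff Q.natDegree = 0 := by rw [h, hQ, Polynomial.eraseLead_coeff_natDegree]
        exact hQ0 (Polynomial.leadingCoeff_eq_zero.1 h1)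
      by_cases hc : SignType.sign P.leadingCoeff = -SignType.sign Q.leadingCoeff
      · rw [if_pos hc]
        -- opposite leading signs force a strict increase of the block index
        have hβne : β Q.natDegree ≠ β P.natDegree := by
          intro hβeq
          have ha : P.leadingCoeff ≠ 0 := Polynomial.leadingCoeff_ne_zero.2 hP
          have ha' : 0 ≤ (-1 : ℝ) ^ β P.natDegree * P.leadingCoeff := hsign P.natDegree
          have hb' : 0 ≤ (-1 : ℝ) ^ β P.natDegree * Q.leadingCoeff := by
            rw [← hβeq]; exact hQsign Q.natDegree
          exact sign_ne_neg_sign_of_pattern ha _ ha' hb' hc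
        have hβlt : β Q.natDegree < β P.natDegree := lt_of_le_of_ne (hβ hdegle) hβne
        omega
      · rw [if_neg hc, add_zero]
        exact hIH.trans (hβ hdegle)

/-- **Zero budget of a block-signed polynomial.**  Under the sign pattern of `signVariations_add_le_of_signPattern`,
every finite set of positive zeros of `P ≠ 0` has at most `β(deg P) − b₀` elements (Descartes' rule, Mathlib
`roots_countP_pos_le_signVariations`). [folklore] -/
theorem card_posZeros_add_le_of_signPattern (β : ℕ → ℕ) (hβ : Monotone β) (P : ℝ[X]) (hP : P ≠ 0)
    (hsign : ∀ n, 0 ≤ (-1 : ℝ) ^ β n * P.coeff n) (b₀ : ℕ) (hb₀ : ∀ n ∈ P.support, b₀ ≤ β n)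
    (T : Finset ℝ) (hT : ∀ r ∈ T, 0 < r ∧ P.eval r = 0) : T.card + b₀ ≤ β P.natDegree := by
  have h1 := signVariations_add_le_of_signPattern β hβ _ P le_rfl hP hsign b₀ hb₀
  have hTsub : T ⊆ P.roots.toFinset.filter (0 < ·) := by
    intro r hr
    obtain ⟨hr0, hfr⟩ := hT r hr
    exact Finset.mem_filter.2 ⟨by rw [Multiset.mem_toFinset, Polynomial.mem_roots hP]; exact hfr, hr0⟩
  have h2 : (P.roots.toFinset.filter (0 < ·)).card ≤ P.signVariations :=
    calc (P.roots.toFinset.filter (0 < ·)).card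
        = (P.roots.filter (0 < ·)).toFinset.card := by rw [Multiset.toFinset_filter]
      _ ≤ (P.roots.filter (0 < ·)).card := Multiset.toFinset_card_le _
      _ = P.roots.countP (0 < ·) := (Multiset.countP_eq_card_filter _ _).symm
      _ ≤ P.signVariations := P.roots_countP_pos_le_signVariations
  have h3 := Finset.card_le_card hTsub
  omega

/-! ## §2 Signs of a real polynomial near `0⁺` and near `+∞` -/

/-- **Sign near `0⁺`.**  A real polynomial `P ≠ 0` has the sign of its trailing coefficient on some interval `(0, δ)`:
with `n₀` the trailing degree, `P(x) = x^{n₀}·g(x)` where `g` is continuous with `g(0) =` the trailing coefficient.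
[folklore] -/
theorem eventually_pos_near_zero (P : ℝ[X]) (s : ℝ) (hs : 0 < s * P.trailingCoeff) :
    ∃ δ : ℝ, 0 < δ ∧ ∀ x : ℝ, 0 < x → x < δ → 0 < s * P.eval x := by
  set n₀ := P.natTrailingDegree with hn₀
  set g : ℝ → ℝ := fun x => ∑ i ∈ Finset.range (P.natDegree + 1), P.coeff i * x ^ (i - n₀) with hg
  have hgc : Continuous g :=
    continuous_finsetSum _ fun i _ => continuous_const.mul (continuous_pow _)
  have hg0 : g 0 = P.trailingCoeff := by
    have hmem : n₀ ∈ Finset.range (P.natDegree + 1) :=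
      Finset.mem_range.2 (Nat.lt_succ_of_le (Polynomial.natTrailingDegree_le_natDegree P))
    rw [hg, Polynomial.trailingCoeff, ← hn₀]
    simp only
    rw [Finset.sum_eq_single n₀]
    · rw [Nat.sub_self, pow_zero, mul_one]
    · intro i _ hi
      rcases lt_or_gt_of_ne hi with h | h
      · rw [Polynomial.coeff_eq_zero_of_lt_natTrailingDegree h, zero_mul]
      · rw [zero_pow (Nat.sub_ne_zero_of_lt h), mul_zero]
    · intro h; exact absurd hmem h
  have hfac : ∀ x : ℝ, 0 < x → P.eval x = x ^ n₀ * g x := by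
    intro x hx
    rw [Polynomial.eval_eq_sum_range, hg]
    simp only
    rw [Finset.mul_sum]
    refine Finset.sum_congr rfl fun i _ => ?_
    rcases lt_or_ge i n₀ with h | h
    · rw [Polynomial.coeff_eq_zero_of_lt_natTrailingDegree h, zero_mul, zero_mul, mul_zero]
    · rw [mul_left_comm, ← pow_add, Nat.add_sub_cancel' h]
  have hev : ∀ᶠ x in nhds (0 : ℝ), 0 < s * g x := by
    have hc : Continuous fun x => s * g x := continuous_const.mul hgc
    have h0 : 0 < s * g 0 := by rw [hg0]; exact hs
    exact hc.continuousAt.eventually (lt_mem_nhds h0)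
  obtain ⟨δ, hδ, hball⟩ := Metric.eventually_nhds_iff.1 hev
  refine ⟨δ, hδ, fun x hx hxδ => ?_⟩
  have h := hball (show dist x 0 < δ by rw [Real.dist_eq, sub_zero, abs_of_pos hx]; exact hxδ)
  rw [hfac x hx, mul_left_comm]
  exact mul_pos (pow_pos hx _) h

/-- **Sign near `+∞`.**  A real polynomial has the sign of its leading coefficient on some interval `(M, ∞)`:
with `N` the degree, `P(x) = x^N·h(1/x)` where `h` is continuous with `h(0) =` the leading coefficient. [folklore] -/
theorem eventually_pos_atTop (P : ℝ[X]) (s : ℝ) (hs : 0 < s * P.leadingCoeff) :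
    ∃ M : ℝ, 0 < M ∧ ∀ x : ℝ, M < x → 0 < s * P.eval x := by
  set N := P.natDegree with hN
  set h : ℝ → ℝ := fun y => ∑ i ∈ Finset.range (N + 1), P.coeff i * y ^ (N - i) with hh
  have hhc : Continuous h :=
    continuous_finsetSum _ fun i _ => continuous_const.mul (continuous_pow _)
  have hh0 : h 0 = P.leadingCoeff := by
    rw [hh, Polynomial.leadingCoeff, ← hN]
    simp only
    rw [Finset.sum_eq_single N]
    · rw [Nat.sub_self, pow_zero, mul_one]
    · intro i hi hiN
      have hlt : i < N := lt_of_le_of_ne (Nat.le_of_lt_succ (Finset.mem_range.1 hi)) hiN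
      rw [zero_pow (Nat.sub_ne_zero_of_lt hlt), mul_zero]
    · intro h; exact absurd (Finset.mem_range.2 (Nat.lt_succ_self N)) h
  have hfac : ∀ x : ℝ, 0 < x → P.eval x = x ^ N * h x⁻¹ := by
    intro x hx
    rw [Polynomial.eval_eq_sum_range, hh, ← hN]
    simp only
    rw [Finset.mul_sum]
    refine Finset.sum_congr rfl fun i hi => ?_
    have hle : i ≤ N := Nat.le_of_lt_succ (Finset.mem_range.1 hi)
    have h : x ^ N = x ^ i * x ^ (N - i) := by rw [← pow_add, Nat.add_sub_cancel' hle]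
    rw [inv_pow, h, mul_assoc, mul_left_comm (x ^ (N - i)), mul_inv_cancel₀ (pow_ne_zero _ hx.ne'), mul_one,
      mul_comm]
  have hev : ∀ᶠ y in nhds (0 : ℝ), 0 < s * h y := by
    have hc : Continuous fun y => s * h y := continuous_const.mul hhc
    have h0 : 0 < s * h 0 := by rw [hh0]; exact hs
    exact hc.continuousAt.eventually (lt_mem_nhds h0)
  obtain ⟨δ, hδ, hball⟩ := Metric.eventually_nhds_iff.1 hev
  refine ⟨δ⁻¹, inv_pos.2 hδ, fun x hx => ?_⟩
  have hx0 : 0 < x := (inv_pos.2 hδ).trans hx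
  have hxinv : x⁻¹ < δ := by rw [inv_lt_comm₀ hx0 hδ]; exact hx
  have h1 := hball (show dist x⁻¹ 0 < δ by
    rw [Real.dist_eq, sub_zero, abs_of_pos (inv_pos.2 hx0)]; exact hxinv)
  rw [hfac x hx0, mul_left_comm]
  exact mul_pos (pow_pos hx0 _) h1

/-! ## §3 Zeros forced by a sign sequence -/

/-- A value of opposite strict signs at `a < b` gives a zero of a continuous function in `(a, b)`. [folklore] -/
theorem exists_zero_of_mul_neg {f : ℝ → ℝ} (hf : Continuous f) {a b : ℝ} (hab : a < b)
    (h : f a * f b < 0) : ∃ z : ℝ, a < z ∧ z < b ∧ f z = 0 := by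
  rcases mul_neg_iff.1 h with h1 | h1
  · obtain ⟨z, hz, hfz⟩ : (0 : ℝ) ∈ f '' Set.Ioo a b :=
      intermediate_value_Ioo' hab.le hf.continuousOn ⟨h1.2, h1.1⟩
    exact ⟨z, hz.1, hz.2, hfz⟩
  · obtain ⟨z, hz, hfz⟩ : (0 : ℝ) ∈ f '' Set.Ioo a b :=
      intermediate_value_Ioo hab.le hf.continuousOn ⟨h1.1, h1.2⟩
    exact ⟨z, hz.1, hz.2, hfz⟩

/-- **Zeros forced by a sign sequence.**  `f` continuous; points `0 < q₀ < q₁ < ⋯ < q_L`; BUDGET: every finite set of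
positive zeros of `f` has at most as many elements as there are SIGN-CHANGING gaps (`f(qᵢ)·f(qᵢ₊₁) < 0`).  Then there are
gap zeros `zᵢ ∈ (qᵢ, qᵢ₊₁)` for the sign-changing gaps, and EVERY positive zero of `f` is one of them.  (The alternating
case is `…DefiniteMoments.gapZeros`.) [folklore] -/
theorem zeros_in_changing_gaps {f : ℝ → ℝ} (hf : Continuous f) {L : ℕ} (q : Fin (L + 1) → ℝ) (hq : StrictMono q)
    (hq0 : 0 < q 0)
    (hbudget : ∀ T : Finset ℝ, (∀ r ∈ T, 0 < r ∧ f r = 0) →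
      T.card ≤ ((Finset.univ : Finset (Fin L)).filter (fun i => f (q i.castSucc) * f (q i.succ) < 0)).card) :
    ∃ z : Fin L → ℝ, (∀ i, f (q i.castSucc) * f (q i.succ) < 0 → q i.castSucc < z i ∧ z i < q i.succ ∧ f (z i) = 0) ∧
      ∀ x : ℝ, 0 < x → f x = 0 → ∃ i, f (q i.castSucc) * f (q i.succ) < 0 ∧ x = z i := by
  classical
  -- gap zeros where the sign changes (anything elsewhere)
  have hch : ∀ i : Fin L, ∃ z : ℝ, f (q i.castSucc) * f (q i.succ) < 0 →
      q i.castSucc < z ∧ z < q i.succ ∧ f z = 0 := by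
    intro i
    by_cases h : f (q i.castSucc) * f (q i.succ) < 0
    · obtain ⟨z, hz1, hz2, hz3⟩ := exists_zero_of_mul_neg hf (hq i.castSucc_lt_succ) h
      exact ⟨z, fun _ => ⟨hz1, hz2, hz3⟩⟩
    · exact ⟨0, fun h' => absurd h' h⟩
  choose z hz using hch
  refine ⟨z, hz, fun x hx hfx => ?_⟩
  set CH := (Finset.univ : Finset (Fin L)).filter (fun i => f (q i.castSucc) * f (q i.succ) < 0) with hCH
  have hzinj : Set.InjOn z CH := by
    intro i hi i' hi' h
    have hi := (Finset.mem_filter.1 hi).2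
    have hi' := (Finset.mem_filter.1 hi').2
    exact gap_eq_of_mem q hq i i' (z i) (hz i hi).1 (hz i hi).2.1 (h ▸ (hz i' hi').1) (h ▸ (hz i' hi').2.1)
  by_contra hne
  push Not at hne
  have hxnot : x ∉ CH.image z := by
    rw [Finset.mem_image]
    rintro ⟨i, hi, hix⟩
    exact hne i (Finset.mem_filter.1 hi).2 hix.symm
  have hT := hbudget (insert x (CH.image z)) (by
    intro r hr
    rw [Finset.mem_insert, Finset.mem_image] at hr
    rcases hr with rfl | ⟨i, hi, rfl⟩
    · exact ⟨hx, hfx⟩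
    · have hi' := (Finset.mem_filter.1 hi).2
      exact ⟨(hq0.trans_le (hq.monotone (Fin.zero_le _))).trans (hz i hi').1, (hz i hi').2.2⟩)
  rw [Finset.card_insert_of_notMem hxnot, Finset.card_image_of_injOn hzinj] at hT
  omega

/-- Gap bookkeeping: a point of gap `i` lying below `q₁` is in gap `0`. [folklore] -/
theorem gap_index_eq_zero {L : ℕ} (q : Fin (L + 1) → ℝ) (hq : StrictMono q) (i : Fin L) (x : ℝ)
    (j₁ : Fin (L + 1)) (hj₁ : (j₁ : ℕ) = 1) (h1 : q i.castSucc < x) (h2 : x < q j₁) : (i : ℕ) = 0 := by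
  by_contra hne
  have hle : q j₁ ≤ q i.castSucc := hq.monotone (by
    rw [Fin.le_def, Fin.val_castSucc, hj₁]; exact Nat.one_le_iff_ne_zero.2 hne)
  linarith

/-- Gap bookkeeping: a point of gap `i` lying above `q_{L−1}` is in the last gap. [folklore] -/
theorem gap_index_eq_last {L : ℕ} (q : Fin (L + 1) → ℝ) (hq : StrictMono q) (i : Fin L) (x : ℝ)
    (jL : Fin (L + 1)) (hjL : (jL : ℕ) + 1 = L) (h1 : q jL < x) (h2 : x < q i.succ) : (i : ℕ) + 1 = L := by
  by_contra hne
  have hi := i.isLt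
  have hlt : (i : ℕ) + 1 ≤ (jL : ℕ) := by omega
  have hle : q i.succ ≤ q jL := hq.monotone (by rw [Fin.le_def, Fin.val_succ]; exact hlt)
  linarith

/-! ## §4 The directed window count for a signed pencil -/

section Directed

variable {ι κ : Type} [Fintype ι] [DecidableEq ι] [Fintype κ]

/-- **Directed window count (downward propagation).**  `F(x) = ∑ₖ x^{dₖ} Sₖ` with real symmetric letters, `c` a real
sign, `p` a decidable set of times.  If for every `v ≠ 0` and all `s < t` in `p`, `0 ≤ c·vᵀF(t)v` forces `0 < c·vᵀF(s)v`,
then `det F` has at most `card ι` distinct zeros in `p`: the kernel vectors at the zeros, enumerated decreasingly, form a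
directed chain for `c • F` (`MomentLaw.card_le_of_directed`). [folklore] -/
theorem card_roots_filter_le_of_directed_down (d : κ → ℕ) (S : κ → Matrix ι ι ℝ) (hS : ∀ k, (S k).IsSymm)
    (c : ℝ) (p : ℝ → Prop) [DecidablePred p]
    (hprop : ∀ v : ι → ℝ, v ≠ 0 → ∀ s t : ℝ, p s → p t → s < t →
      0 ≤ c * (v ⬝ᵥ ((∑ k, t ^ d k • S k) *ᵥ v)) → 0 < c * (v ⬝ᵥ ((∑ k, s ^ d k • S k) *ᵥ v))) :
    ((Matrix.det (∑ k, ((X : ℝ[X]) ^ d k) • (S k).map C)).roots.toFinset.filter p).card ≤ Fintype.card ι := by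
  set R := (Matrix.det (∑ k, ((X : ℝ[X]) ^ d k) • (S k).map C)).roots.toFinset.filter p with hR
  let τ : Fin R.card ↪o ℝ := R.orderEmbOfFin rfl
  have hτmem : ∀ j, τ j ∈ R := fun j => R.orderEmbOfFin_mem rfl j
  have hτp : ∀ j, p (τ j) := fun j => (Finset.mem_filter.1 (hτmem j)).2
  have hτdet : ∀ j, (∑ k, τ j ^ d k • S k).det = 0 := fun j =>
    det_eval_eq_zero_of_mem d S (Finset.mem_filter.1 (hτmem j)).1
  have hGsymm : ∀ x : ℝ, (c • ∑ k, x ^ d k • S k).IsSymm := fun x => (isSymm_eval d S hS x).smul c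
  have hform : ∀ (x : ℝ) (v : ι → ℝ),
      v ⬝ᵥ ((c • ∑ k, x ^ d k • S k) *ᵥ v) = c * (v ⬝ᵥ ((∑ k, x ^ d k • S k) *ᵥ v)) := by
    intro x v
    rw [Matrix.smul_mulVec, dotProduct_smul, smul_eq_mul]
  refine MomentLaw.card_le_of_directed (fun x => c • ∑ k, x ^ d k • S k) (fun s t => t < s) {x | p x}
    (fun s _ => hGsymm s) ?_ (fun j => τ (Fin.rev j)) (fun j => hτp _)
    (fun i j hij => τ.strictMono (Fin.rev_lt_rev.2 hij)) ?_
  · intro s hs t ht hts v hv hsv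
    rw [hform] at hsv ⊢
    exact hprop v hv t s ht hs hts hsv
  · intro j
    show (c • ∑ k, τ (Fin.rev j) ^ d k • S k).det = 0
    rw [Matrix.det_smul, hτdet, mul_zero]

end Directed

end DefiniteMoments

end Summit.ValiantsHypothesis.ValiantsHypothesis.Theorems.LacunarySymmetroidMatrixDescartes
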